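import Mathlib.Tactic
import HarnessLib
import HarnessLib.Audit.Tags
import Summits.CriticalPhenomena.PercolationContinuityZ3.Theorems.PercNearOneGluingNoHeavyLowerTailSahiAntichainSplit

/-!
# Antichains: meets plus joins — effective points, the split step, V5 for small families, and the good-point-or-rich dichotomy

Support file (seat `prim-masterthm-p1`, gen 35; `--supports stmt-CriticalPhenomena-4575`).  No `sorry`, standard axioms.  Builds on the split
identity and the one-sided step of `…SahiAntichainSplit`.  Memo `run/shared/lean/prim/prim-masterthm/FROM-prim-masterthm-p1-g35-SPLIT-STEP.md`.

TARGET.  **V5** (gen 34): every antichain `P` with `#P ≥ 2` has `#meets P + #joins P ≥ 2 #P − 2`.  With the split identity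
`f P = f (above P r) + f (below P r) + newLabels P r` (`f = #meets + #joins`, any point `r`), V5 follows by strong induction on `#P` at any
EFFECTIVE point `r` (both sides non-empty) as soon as EITHER `newLabels P r ≥ 2` OR `P` is already RICH (`#meets P ≥ #P − 1` and
`#joins P ≥ #P − 1`).

NEW HERE ([this work], gen 35).
* `effPoints`, `effPoints_nonempty`: two distinct members of an antichain are separated by an effective point.
* **The split step** `two_mul_card_le_step`: if `newLabels P r ≥ 2` at an effective point and V5 holds for both sides, then V5 holds for `P`
  (unconditional lemma; the engine of every induction below).
* **V5 for `#P ≤ 3`** (`two_mul_card_le_of_card_le_three`), unconditionally, through the one-sided step of `…SahiAntichainSplit`.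
* **V5 ⟹ V1** (`card_le_or_card_le_of_two_mul_card_le`): `#P ≤ #meets + 1 ∨ #P ≤ #joins + 1`; and `antichainMeetsOrJoins_iff` records that the
  sets of `AntichainMeetsOrJoins` (`…SahiRainbowIsolated`) are `insert ∅ (meets P)` / `insert F (joins P)`.
* **CONJECTURE `AntichainGoodPointOrRich` (typed)** — the dichotomy: every antichain with `#P ≥ 2` has an effective point with
  `newLabels ≥ 2`, OR satisfies `#P ≤ #meets P + 1` and `#P ≤ #joins P + 1`.  `two_mul_card_le_of_goodPointOrRich`: it implies V5.
  EVIDENCE (engines `prim-masterthm-p1/code-g35/`): exhaustive on all antichains of `2^n`, `n ≤ 6` (7 828 289 for `n = 6`; there EVERY antichain even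
  has a good point, and at the 480 (antichain, point) instances with `newLabels ≤ 1` one has `min(#meets,#joins) ≥ #P + 4`); annealing campaigns on
  `2^7 … 2^9` (kit j280295, j280446) found no counterexample; V5 itself survives annealing on `2^7 … 2^10` up to `#P = 90` (kit j280217).
* **REFUTED STRENGTHENINGS (recorded so they are not retried).**  (i) "every antichain has a good point" is FALSE: a 44-member antichain of `2^8`
  (kit j279773; memo §3) has `newLabels ≤ 1` at every point (it is rich: `#meets = 88`).  (ii) Hence the averaged form "`∑_r newLabels ≥ 2 #effPoints`"
  (true for all antichains of `2^≤6`) is false at `n = 8`.  (iii) "`#newJoins P r ≤ 1 ⟹ #meets P ≥ #P − 1`" (true on `2^≤6`) is false at `n = 7`: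
  `{45} ∪ {xy6 : xy ⊂ {0,…,5}, xy ≠ 45}` at `r = 6` (there `#newMeets = 3`).  The dichotomy above is the form consistent with all data.
HONEST FRAMING: V5, `AntichainGoodPointOrRich` and `AntichainMeetsOrJoins` remain OPEN; the step lemma, the case `#P ≤ 3`, V5 ⟹ V1 and the
reduction are unconditional. [this work]
-/

namespace Summit.CriticalPhenomena.PercolationContinuityZ3.Theorems.SahiColouredDaykin

open Finset

variable {α : Type*} [DecidableEq α]

/-! ### 1. Effective points -/

/-- The EFFECTIVE points of `P`: points lying in some member and outside some other member (both sides of the split non-empty). [this work] -/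
def effPoints (P : Finset (Finset α)) : Finset α := (P.sup id).filter fun r => (below P r).Nonempty

/-- Unpacking `effPoints`. [this work] -/
theorem mem_effPoints_iff {P : Finset (Finset α)} {r : α} :
    r ∈ effPoints P ↔ (above P r).Nonempty ∧ (below P r).Nonempty := by
  unfold effPoints
  rw [mem_filter, mem_sup]
  constructor
  · rintro ⟨⟨a, ha, hra⟩, hB⟩
    exact ⟨⟨a, mem_above_iff.2 ⟨ha, hra⟩⟩, hB⟩
  · rintro ⟨⟨a, ha⟩, hB⟩
    obtain ⟨haP, hra⟩ := mem_above_iff.1 ha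
    exact ⟨⟨a, haP, hra⟩, hB⟩

/-- Two distinct members are separated by an effective point. [this work] -/
theorem effPoints_nonempty {P : Finset (Finset α)} (h2 : 2 ≤ #P) : (effPoints P).Nonempty := by
  obtain ⟨a, ha, b, hb, hab⟩ := one_lt_card.1 (by omega : 1 < #P)
  have : ¬(a ⊆ b ∧ b ⊆ a) := fun h => hab (Subset.antisymm h.1 h.2)
  rcases not_and_or.1 this with h | h
  · obtain ⟨x, hxa, hxb⟩ := not_subset.1 h
    exact ⟨x, mem_effPoints_iff.2 ⟨⟨a, mem_above_iff.2 ⟨ha, hxa⟩⟩, ⟨b, mem_below_iff.2 ⟨hb, hxb⟩⟩⟩⟩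
  · obtain ⟨x, hxb, hxa⟩ := not_subset.1 h
    exact ⟨x, mem_effPoints_iff.2 ⟨⟨b, mem_above_iff.2 ⟨hb, hxb⟩⟩, ⟨a, mem_below_iff.2 ⟨ha, hxa⟩⟩⟩⟩

/-! ### 2. The split step -/

/-- The two sides of a split are sub-antichains. [this work] -/
theorem isAntichain_above {P : Finset (Finset α)} (hanti : IsAntichain (· ⊆ ·) (P : Set (Finset α))) (r : α) :
    IsAntichain (· ⊆ ·) (above P r : Set (Finset α)) :=
  hanti.subset (coe_subset.2 (above_subset P r))

/-- The two sides of a split are sub-antichains. [this work] -/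
theorem isAntichain_below {P : Finset (Finset α)} (hanti : IsAntichain (· ⊆ ·) (P : Set (Finset α))) (r : α) :
    IsAntichain (· ⊆ ·) (below P r : Set (Finset α)) :=
  hanti.subset (coe_subset.2 (below_subset P r))

/-- **The split step.**  If the split at `r` creates at least two new labels and V5 (in the form `2 #Q ≤ #meets Q + #joins Q + 2`) holds for both
sides, then V5 holds for `P`.  (For a side with at most one member the hypothesis is automatic.) [this work] -/
theorem two_mul_card_le_step (P : Finset (Finset α)) (r : α) (hnew : 2 ≤ newLabels P r)
    (hA : 2 * #(above P r) ≤ #(meets (above P r)) + #(joins (above P r)) + 2)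
    (hB : 2 * #(below P r) ≤ #(meets (below P r)) + #(joins (below P r)) + 2) :
    2 * #P ≤ #(meets P) + #(joins P) + 2 := by
  have hsplit := card_meets_add_card_joins_split P r
  have hcard := card_above_add_card_below P r
  omega

/-- The rich case needs no induction: `#P ≤ #meets + 1` and `#P ≤ #joins + 1` give V5 at once. [this work] -/
theorem two_mul_card_le_of_rich (P : Finset (Finset α)) (hL : #P ≤ #(meets P) + 1) (hJ : #P ≤ #(joins P) + 1) :
    2 * #P ≤ #(meets P) + #(joins P) + 2 := by
  omega

/-! ### 3. V5 for at most three members (unconditional) -/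

/-- Good points exist unconditionally when `#P ≤ 3`: every effective point has a side with a single member. [this work] -/
theorem exists_goodPoint_of_card_le_three {P : Finset (Finset α)}
    (hanti : IsAntichain (· ⊆ ·) (P : Set (Finset α))) (h2 : 2 ≤ #P) (h3 : #P ≤ 3) :
    ∃ r, (above P r).Nonempty ∧ (below P r).Nonempty ∧ 2 ≤ newLabels P r := by
  obtain ⟨r, hr⟩ := effPoints_nonempty h2
  obtain ⟨hA, hB⟩ := mem_effPoints_iff.1 hr
  refine ⟨r, hA, hB, ?_⟩
  have hsum := card_above_add_card_below P r
  have hApos : 0 < #(above P r) := card_pos.2 hA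
  have hBpos : 0 < #(below P r) := card_pos.2 hB
  by_cases hA1 : #(above P r) = 1
  · exact two_le_newLabels_of_card_above_eq_one hanti h2 hA1
  · exact two_le_newLabels_of_card_below_eq_one hanti h2 (by omega)

/-- **V5 holds unconditionally for antichains with at most three members** (the sides of a split have fewer members, so the induction closes
inside `#P ≤ 3`). [this work] -/
theorem two_mul_card_le_of_card_le_three :
    ∀ P : Finset (Finset α), IsAntichain (· ⊆ ·) (P : Set (Finset α)) → #P ≤ 3 → 2 * #P ≤ #(meets P) + #(joins P) + 2 := by
  suffices H : ∀ n, ∀ P : Finset (Finset α), #P = n → #P ≤ 3 → IsAntichain (· ⊆ ·) (P : Set (Finset α)) →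
      2 * #P ≤ #(meets P) + #(joins P) + 2 from fun P hP h3 => H _ P rfl h3 hP
  intro n
  induction n using Nat.strong_induction_on with
  | _ n ih =>
    intro P hPn h3 hanti
    by_cases h2 : 2 ≤ #P
    · obtain ⟨r, hA, hB, hnew⟩ := exists_goodPoint_of_card_le_three hanti h2 h3
      have hcard := card_above_add_card_below P r
      have hApos : 0 < #(above P r) := card_pos.2 hA
      have hBpos : 0 < #(below P r) := card_pos.2 hB
      have ihA := ih (#(above P r)) (by omega) (above P r) rfl (by omega) (isAntichain_above hanti r)
      have ihB := ih (#(below P r)) (by omega) (below P r) rfl (by omega) (isAntichain_below hanti r)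
      exact two_mul_card_le_step P r hnew ihA ihB
    · omega

/-! ### 4. The good-point-or-rich dichotomy and V5 -/

/-- **CONJECTURE (good point or rich; typed).**  Every antichain with at least two members either has an effective point whose split creates
at least two new labels, or is already rich: `#P ≤ #meets P + 1` and `#P ≤ #joins P + 1`.  Exhaustive on `2^n`, `n ≤ 6`; annealing-clean on
`2^7 … 2^9` (file header); the pure good-point form is FALSE (`n = 8`, file header). [this work] [status: open] -/
@[conjecture] def AntichainGoodPointOrRich (α : Type*) [DecidableEq α] : Prop :=
  ∀ P : Finset (Finset α), IsAntichain (· ⊆ ·) (P : Set (Finset α)) → 2 ≤ #P →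
    (∃ r, (above P r).Nonempty ∧ (below P r).Nonempty ∧ 2 ≤ newLabels P r) ∨ (#P ≤ #(meets P) + 1 ∧ #P ≤ #(joins P) + 1)

/-- **The dichotomy implies V5**, by strong induction on `#P` through the split step. [this work] -/
theorem two_mul_card_le_of_goodPointOrRich (h : AntichainGoodPointOrRich α) :
    ∀ P : Finset (Finset α), IsAntichain (· ⊆ ·) (P : Set (Finset α)) → 2 * #P ≤ #(meets P) + #(joins P) + 2 := by
  suffices H : ∀ n, ∀ P : Finset (Finset α), #P = n → IsAntichain (· ⊆ ·) (P : Set (Finset α)) →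
      2 * #P ≤ #(meets P) + #(joins P) + 2 from fun P hP => H _ P rfl hP
  intro n
  induction n using Nat.strong_induction_on with
  | _ n ih =>
    intro P hPn hanti
    by_cases h2 : 2 ≤ #P
    · rcases h P hanti h2 with ⟨r, hA, hB, hnew⟩ | ⟨hL, hJ⟩
      · have hcard := card_above_add_card_below P r
        have hApos : 0 < #(above P r) := card_pos.2 hA
        have hBpos : 0 < #(below P r) := card_pos.2 hB
        have ihA := ih (#(above P r)) (by omega) (above P r) rfl (isAntichain_above hanti r)
        have ihB := ih (#(below P r)) (by omega) (below P r) rfl (isAntichain_below hanti r)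
        exact two_mul_card_le_step P r hnew ihA ihB
      · exact two_mul_card_le_of_rich P hL hJ
    · omega

/-! ### 5. V5 ⟹ V1, and the link to `AntichainMeetsOrJoins` -/

/-- **V5 ⟹ V1**: `2 #P ≤ #meets + #joins + 2` forces `#P ≤ #meets + 1` or `#P ≤ #joins + 1`. [this work] -/
theorem card_le_or_card_le_of_two_mul_card_le {P : Finset (Finset α)} (h : 2 * #P ≤ #(meets P) + #(joins P) + 2) :
    #P ≤ #(meets P) + 1 ∨ #P ≤ #(joins P) + 1 := by
  by_contra hno
  push Not at hno
  omega

/-- V1 for at most three members, unconditionally. [this work] -/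
theorem card_le_or_card_le_of_card_le_three (P : Finset (Finset α)) (hanti : IsAntichain (· ⊆ ·) (P : Set (Finset α)))
    (h3 : #P ≤ 3) : #P ≤ #(meets P) + 1 ∨ #P ≤ #(joins P) + 1 :=
  card_le_or_card_le_of_two_mul_card_le (two_mul_card_le_of_card_le_three P hanti h3)

/-- The sets of `AntichainMeetsOrJoins` are `insert ∅ (meets P)` and `insert F (joins P)` (definitional bookkeeping). [this work] -/
theorem antichainMeetsOrJoins_iff (α : Type*) [DecidableEq α] :
    AntichainMeetsOrJoins α ↔ ∀ (F : Finset α) (P : Finset (Finset α)), (∀ S ∈ P, S ⊆ F) → (∀ S ∈ P, F \ S ∉ P) →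
      IsAntichain (· ⊆ ·) (P : Set (Finset α)) → #P ≤ #(insert ∅ (meets P)) ∨ #P ≤ #(insert F (joins P)) :=
  Iff.rfl

/-- `#P ≤ #meets + 1 ≤ #(insert ∅ (meets P)) + [∅ ∈ meets P]`: when `∅` is not a meet of two members, V1's first alternative already gives the
first alternative of `AntichainMeetsOrJoins`. [this work] -/
theorem card_le_card_insert_empty_of_not_mem {P : Finset (Finset α)} (h : #P ≤ #(meets P) + 1) (h0 : (∅ : Finset α) ∉ meets P) :
    #P ≤ #(insert ∅ (meets P)) := by
  rw [card_insert_of_notMem h0]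
  exact h

/-- Dually with the top set `F`. [this work] -/
theorem card_le_card_insert_top_of_not_mem {P : Finset (Finset α)} {F : Finset α} (h : #P ≤ #(joins P) + 1) (hF : F ∉ joins P) :
    #P ≤ #(insert F (joins P)) := by
  rw [card_insert_of_notMem hF]
  exact h

end Summit.CriticalPhenomena.PercolationContinuityZ3.Theorems.SahiColouredDaykin
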